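import Summits.NavierStokesRegularity.NavierStokesRegularity.Theorems.FilamentSkeletonRssDefectColumnGateDefs
import Summits.NavierStokesRegularity.NavierStokesRegularity.Theorems.FilamentSkeletonRssDefectColumnGateClosingIVT
import Summits.NavierStokesRegularity.NavierStokesRegularity.Theorems.FilamentSkeletonRssDefectColumnGateContinuity
import HarnessLib.Audit

/-!
# Line `defect_column_gate_1AG` for the crux `FilamentSkeletonRss.TransverseReduction1AG` (stmt-NavierStokesRegularity-27853)

**LEAD EDIT (ns-filament-21221-p1 g10, LEAD of 27853, 2026-08-28) — skeleton v4.**  S2a `WaistColumnGate1A` is FALSE AS TYPED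
(far-field quasimodes of the frozen sectional operator under strain asymmetry `s > gam/4` in the weight `⟨ξ⟩⁴`, and for `s ≥ gam/2` in every
polynomial weight; memo `filament-plan/S2A-FALSE-FARFIELD-27853-g10.md` = evidence #25 on stmt-27853; the operator identity `colForceVort_eq`
is kernel-checked, `Theorems/FilamentSkeletonRssDefectColumnGateColumnVorticity.lean` p651775).  RESHAPE: S2a → **S2a-loc
`stub_waistColumnGateLoc1A : WaistColumnGateLoc1A`** (the same sectional a-priori bound for perturbations supported in the sectional cylinder of
radius `R`, loss `C·Rc^q·R^q` — what S2b actually consumes at its patch radius `Γ^ε`), S2b → **S2b-loc `stub_gateAssemblyLoc1AG :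
GateAssemblyLoc1AG := RateSelection1AG → WaistColumnGateLoc1A → DefectGate1AG`**; vocabulary in `Theorems/…DefectColumnGateDefs.lean` §7
(p652683).  S0, S1, S3 (proved) and the composition are unchanged.  Registered stubs after this edit: S0 `stub_rateSelection1AG`, S1
`stub_familyDressing1AG`, S2a-loc `stub_waistColumnGateLoc1A`, S2b-loc `stub_gateAssemblyLoc1AG`.  Typed RISK carried by S2b-loc (memo §5(b)):
near-neutral / expanding EXTERNAL sectional strain at a waist ⇒ spatial amplification across the hyperbolic annulus (the crux's «waist wall»).

**LEAD EDIT (ns-filament-21221-p1 g9, LEAD of 27853 per DIRECTOR-NS #238, 2026-08-28).**  (i) The line's VOCABULARY (§§1–4 and §6 of the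
strategist's file 6198e7c4afcffc7b) now lives VERBATIM in `Theorems/FilamentSkeletonRssDefectColumnGateDefs.lean` (importable; opened below), so
that stub proofs can state the registered stubs BY NAME; this workfile keeps only the registered `stub_*`, the glue and `TransverseReduction1AG_of`.
(ii) S3 `DefectClosing1AG` is SPLIT into S3a `stub_closingIVT1AG : ClosingIVT1AG` (:= `DefectContinuity1AG → DefectClosing1AG`, the analytic
half: per-β frozen-rate contraction + IVT + bookkeeping) and S3b `stub_defectContinuity1AG : DefectContinuity1AG` (the topological half:
continuity of `β ↦ 𝓫_β G_β` on the closed window); `defectClosing1AG_of_stubs` recombines them, `lineGlue1AG` is unchanged.  LEAD FLAG on S3b: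
gate clauses (3)/(4) are qualitative (ε–δ on balls); if S3b resists as typed the repair is a quantitative tightness clause (3′), which also
re-targets S2b.  Registered stubs after the edit: S0 `stub_rateSelection1AG`, S1 `stub_familyDressing1AG`, S2a `stub_waistColumnGate1A`, S2b
`stub_gateAssembly1AG`; S3a `stub_closingIVT1AG` and S3b `stub_defectContinuity1AG` are PROVED (p646026 / p646054) and wired below, so the
whole closing step S3 `DefectClosing1AG` is a THEOREM of the tree (`defectClosing1AG_of_stubs`); remaining sorries = S0, S1, S2a, S2b.  The
strategist's text follows unchanged.


Third strategist line (seat `cstrat-stmt-NavierStokesRegularity-21221-g3`, 2026-08-28) for the LIVE successor of the strategist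
payload crux `TransverseReductionRJ` (stmt-21221, an ASIDE since route rev 14): after the A1G cone-thinness retype (route rev 22–24,
tenure g11) the crux of record is `TransverseReduction1AG` (stmt-27853: the A1α text plus the binder `KA` and the Γ-flat all-τ
core-area clause).  This file re-cuts the gen-2 line `column_gate_1A` so that

(O1) the tenure g10 objection is ANSWERED BY CONSTRUCTION.  O1 (verified by hand in this seat's NOTES): a bordered gate whose rate
     column is `b·𝓡U⁰` with the base FROZEN (`GateSpec1A` of `free_rate_gate_1A` / `column_gate_1A`) cannot be X-bounded uniformly
     in the rate — the far-field pitch of the dressed base is locked to the frame rate (`(α⁰𝓡 + ½ + ½y·∇)U⁰_tail = O(⟨y⟩⁻²)`), so at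
     `α′ = α⁰` the column is resonant with the similarity transport (`W ~ log⟨y⟩·𝓡U⁰_tail ∉ X`) and for `α′ ≠ α⁰` the response is
     `−b U⁰_tail/(α′−α⁰)`.  HERE the rate is carried by a RE-WOUND BASE FAMILY `β ↦ U⁰_β` (exact frame rate `α⁰+β`, ends re-wound),
     and the linear gate at member `β` is bordered by the COMPACTLY SUPPORTED defect column `Z_β = χ·𝓡U⁰_β` (cut off at
     `2–4·Rb√(Γ log Γ)`), which is Y-class: no resonance, no far field in the column.  The exact rate is then found by a
     one-dimensional intermediate-value argument on the scalar DEFECT `g(β) + 𝓫_β(…)` (S3), not by a joint `(W, β)` contraction.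
(T)  FIRST-ORDER RATE SELECTION is an explicit, skeleton-level, kill-first stub `RateSelection1AG` (S0): clause 13-J of the crux
     AUGMENTED by the rate column and tested IN THE BALL only (the kit ns-idea-12 §10.4(3) observation — an all-τ augmented clause
     forces `dα = 0` for `a < 1` — is met by restricting the hypothesis to `‖X j τ‖ ≤ Rb√(Γ log Γ)`).  Its content is exactly the
     non-degeneracy `⟨ψ*, 𝓡U⟩ ≠ 0` that the crux's why-might-fail names («rate transversality is global, not a clause; selection may
     go 2nd order»), typed with a polynomial loss `cR·Γ^q`, and it is MODEL-checkable on the lane's skeleton data (smallest singular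
     value of the augmented in-ball operator vs the phase-only one).  It is consumed twice: by the dressing S1 (order-by-order rate
     corrections) and by the gate assembly S2b (the reduced m = 1 / rate block).
(G)  the A1G text: binder `KA` and the clause `Rw²Γ·Aa j τ ≤ KA·(Rw²Γ + ‖X j τ‖²)` threaded through every statement (`Clauses1G`).

Stubs (5, sizes in the line card; S2a/S2b superseded by S2a-loc/S2b-loc, lead g10): S0 `stub_rateSelection1AG : RateSelection1AG` (M–L; KILL-FIRST #1, skeleton level) ·
S1 `stub_familyDressing1AG : RateSelection1AG → DefectFamily1AG` (XL) · S2a `stub_waistColumnGate1A : WaistColumnGate1A` (L;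
KILL-FIRST #2; VERBATIM the gen-2 statement — same name and text, so stub work transfers) · S2b `stub_gateAssembly1AG :
RateSelection1AG → WaistColumnGate1A → DefectGate1AG` (XL; the judge's Kelvin-band risk lives here and only here) · S3
`stub_defectClosing1AG : DefectClosing1AG` (L).  Composition: `TransverseReduction1AG_of := transverseReduction1AG_iff.mpr
(lineGlue1AG (stub_familyDressing1AG stub_rateSelection1AG) (stub_gateAssembly1AG stub_rateSelection1AG stub_waistColumnGate1A)
stub_defectClosing1AG)` — the crux BY NAME.

HONEST FRAMING.  Bookkeeping for a HYPOTHETICAL filament-type rotating-self-similar blow-up route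
(`route-NavierStokesRegularity-FilamentSkeletonRss`, refutation side: `closes … : ¬ NavierStokesRegularity`).  Nothing in this
file moves Navier–Stokes regularity.  MODEL rung, negative side.  `lean check`: rc 0, sorries = 5 (only `stub_*`).
-/

set_option linter.dupNamespace false

noncomputable section

namespace Summit.NavierStokesRegularity.NavierStokesRegularity.Cruxes.TransverseReduction1AG.DefectColumnGate

open scoped BigOperators Topology Manifold Classical MeasureTheory ProbabilityTheory Matrix InnerProductSpace ComplexConjugate ContinuousMap ENNReal ContDiff
open Filter Set Function TopologicalSpace MeasureTheory
open Literature.NS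
open Literature.Analysis.FluidPDE
open Summit.NavierStokesRegularity.NavierStokesRegularity.Theses.FilamentSkeletonRss
open Summit.NavierStokesRegularity.NavierStokesRegularity.Theorems.KelvinGate (lerayOp lerayLin XBound YBound LocClose)
open Summit.NavierStokesRegularity.NavierStokesRegularity.Theorems.DefectColumnGate


/-! ## 1–4. VOCABULARY: moved verbatim to `Theorems/FilamentSkeletonRssDefectColumnGateDefs.lean` (LEAD g9), opened above.
The registered stub signatures below (`RateSelection1AG`, `FamilyDressing1AG`, `WaistColumnGate1A`, `GateAssembly1AG`, `ClosingIVT1AG`,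
`DefectContinuity1AG`) are those constants; a stub proof is `theorem stub_<name> : <Name> := …` in any Theorems file importing the Defs. -/

/-! ## 5. Registered stubs and the kernel-checked composition -/

/-- **Stub S0** (`RateSelection1AG`) — KILL-FIRST #1: skeleton-level, one augmented linear map per skeleton; prove it or refute it. -/
theorem stub_rateSelection1AG : RateSelection1AG := by
  sorry

/-- **Stub S1** (`FamilyDressing1AG`) — matched asymptotics with rate corrections, re-wound ends, forced window. -/
theorem stub_familyDressing1AG : FamilyDressing1AG := by
  sorry

/-- **Stub S2a-loc** (`WaistColumnGateLoc1A`) — KILL-FIRST #2: one explicit linear operator, SECTIONALLY LOCALISED (radius `R`, loss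
`C·Rc^q·R^q`); replaces `WaistColumnGate1A`, which is false as typed (lead g10, evidence #25). -/
theorem stub_waistColumnGateLoc1A : WaistColumnGateLoc1A := by
  sorry

/-- **Stub S2b-loc** (`GateAssemblyLoc1AG`) — patching: rate selection + LOCALISED sectional gate ⟹ defect-bordered gate. -/
theorem stub_gateAssemblyLoc1AG : GateAssemblyLoc1AG := by
  sorry

/-- **Stub S3a** (`ClosingIVT1AG`) — PROVED by the lead (Theorems/FilamentSkeletonRssDefectColumnGateClosingIVT.lean, p646026):
frozen-rate contraction + IVT on the scalar defect, given the continuity S3b. -/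
theorem stub_closingIVT1AG : ClosingIVT1AG :=
  Summit.NavierStokesRegularity.NavierStokesRegularity.Theorems.DefectColumnGate.stub_closingIVT1AG

/-- **Stub S3b** (`DefectContinuity1AG`) — PROVED by the lead (Theorems/FilamentSkeletonRssDefectColumnGateContinuity.lean, p646054):
continuity of `β ↦ 𝓫_β G_β` on the closed window (Picard truncation + finite regress of balls). -/
theorem stub_defectContinuity1AG : DefectContinuity1AG :=
  Summit.NavierStokesRegularity.NavierStokesRegularity.Theorems.DefectColumnGate.stub_defectContinuity1AG

/-- **S3 `DefectClosing1AG` — a THEOREM** (both halves proved by the lead; no sorry in its cone). -/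
theorem defectClosing1AG_of_stubs : DefectClosing1AG :=
  stub_closingIVT1AG stub_defectContinuity1AG

/-- **Glue (pure logic + the LANDED smoothing ladder, no sorry).** -/
theorem lineGlue1AG (h1 : DefectFamily1AG) (h2 : DefectGate1AG) (h3 : DefectClosing1AG) : CutForm1AG := by
  intro N δ ρ K Λ a b cnd η Rw Rb cg θ₀ KA hN hδ hρ ha hη hRw hRb hcg hθ₀
  obtain ⟨Cs, hS1⟩ := h1 N δ ρ K Λ a b cnd η Rw Rb cg θ₀ KA hN hδ hρ ha hη hRw hRb hcg hθ₀
  obtain ⟨κ, C₂, q₀, k₀, hS2⟩ := h2 N δ ρ K Λ a b cnd η Rw Rb cg θ₀ KA hN hδ hρ ha hη hRw hRb hcg hθ₀ Cs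
  obtain ⟨q₁, hq, k, hk₀, hk, hS3⟩ := h3 N δ ρ K Λ a b cnd η Rw Rb cg θ₀ KA hN hδ hρ ha hη hRw hRb hcg hθ₀ Cs κ C₂ q₀ k₀
  obtain ⟨Cr, Γa, hS1'⟩ := hS1 q₁ k
  obtain ⟨Γb, hS2'⟩ := hS2 q₁ hq k hk₀ hk Cr
  obtain ⟨Γc, hS3'⟩ := hS3 Cr
  refine ⟨max Γa (max Γb Γc), ?_⟩
  intro Γ hΓ γ α X w c m n Aa u v A T hu hv hA hT hcl
  have hΓa : Γa ≤ Γ := le_trans (le_max_left _ _) hΓ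
  have hΓb : Γb ≤ Γ := le_trans (le_trans (le_max_left _ _) (le_max_right _ _)) hΓ
  have hΓc : Γc ≤ Γ := le_trans (le_trans (le_max_right _ _) (le_max_right _ _)) hΓ
  obtain ⟨α0, β₀, U0, P0, Z, g, r, hfam⟩ := hS1' Γ hΓa γ α X w c m n Aa u v A T hu hv hA hT hcl
  obtain ⟨𝓚, 𝓠, 𝓫, hgate⟩ := hS2' Γ hΓb γ α X w c m n Aa u v A T hu hv hA hT hcl α0 β₀ U0 P0 Z g r hfam
  obtain ⟨α₁, C₀, M, U, P, hU⟩ := hS3' Γ hΓc γ α X w c m n Aa u v A T hu hv hA hT hcl α0 β₀ U0 P0 Z g r hfam 𝓚 𝓠 𝓫 hgate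
  obtain ⟨hα₁, hne, hU2, hP1, hdiv, heq, hdec, hPM, hwin⟩ := hU
  have hF : ContDiff ℝ ∞ (fun _ : EuclideanSpace ℝ (Fin 3) => (0 : EuclideanSpace ℝ (Fin 3))) := contDiff_const
  have hUs : ContDiff ℝ ∞ U :=
    Theorems.KelvinGate.Smoothing.contDiff_velocity_infty (F := fun _ => 0) hU2 hdiv hP1 hF heq
  have hPs : ContDiff ℝ ∞ P :=
    Theorems.KelvinGate.Smoothing.contDiff_pressure_infty (F := fun _ => 0) hU2 hdiv hP1 hF heq
  exact ⟨α₁, C₀, M, U, P, hα₁, hne, hUs, hPs, hdiv, heq, hdec, hPM, hwin⟩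

/-- **The skeleton (A12 shape): the crux BY NAME from the registered stubs** — S1's conclusion is
`stub_familyDressing1AG stub_rateSelection1AG`, S2b-loc's is `stub_gateAssemblyLoc1AG stub_rateSelection1AG stub_waistColumnGateLoc1A`, S3 is
`stub_closingIVT1AG stub_defectContinuity1AG` (lead reshapes g9 / g10). -/
theorem TransverseReduction1AG_of : TransverseReduction1AG :=
  transverseReduction1AG_iff.mpr
    (lineGlue1AG (stub_familyDressing1AG stub_rateSelection1AG)
      (stub_gateAssemblyLoc1AG stub_rateSelection1AG stub_waistColumnGateLoc1A) defectClosing1AG_of_stubs)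


end Summit.NavierStokesRegularity.NavierStokesRegularity.Cruxes.TransverseReduction1AG.DefectColumnGate

end
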